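import Summits.NavierStokesRegularity.NavierStokesRegularity.Theorems.FilamentSkeletonRssKelvinGateTools

/-!
# Route `FilamentSkeletonRss` · crux `TransverseReductionRJ` (stmt-NavierStokesRegularity-21221) — line `kelvin_gate`,
# stub S2 `PolynomialKelvinGate`: the ORDER-ONE REDUCTION of the stub

Helper file (theorems only, `--supports stmt-NavierStokesRegularity-21221 --as helper`), in the vocabulary of
`FilamentSkeletonRssKelvinGateDefs` / `…Tools`.  HONEST FRAMING: bookkeeping for a HYPOTHETICAL filament-type RSS
blow-up route; nothing here bears on Navier–Stokes regularity; the stub is neither proved nor refuted here.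

WHAT THIS FILE RECORDS.  Stub S2 reads `∀ Cs, ∃ κ C₂, ∀ k ≥ 1, ∀ Cr, ∃ Γ₁, ∀ Γ ≥ Γ₁, … BaseSpec(k, Cs, Cr) → ∃ gate(κ, C₂)`:
the gate constants are chosen BEFORE the dressing order `k` and the residual constant `Cr`, and the threshold `Γ₁`
after them.  Since the residual clause of `BaseSpec` is `Y(r_p) ≤ Cr · Γ^{-k}`, which only gets STRONGER as `k` grows
(`Γ ≥ 1`, `Cr ≥ 0` — `BaseSpec.pos`), the class of base families of order `k` is contained in the class of order `1`
with the same `Cr` (`BaseSpec.of_order_le`).  Consequently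

* `polynomialKelvinGate_iff_order_one` — **S2 is EQUIVALENT to its restriction to `k = 1`**: a polynomial Kelvin gate,
  with constants uniform in `Cr`, around EVERY base family whose residual modulo accretion modes is merely `≤ Cr·Γ⁻¹`
  in the Y-scale, `Cr` arbitrary (fixed before `Γ₁`).  The "all-orders" decoupling of the line (the dressing pays
  `Γ^{-k}` for the gate's loss `Γ^κ`) therefore does NOT reach the hypothesis of S2 as typed: "κ, C₂ independent of
  `k`" is automatic, and no strength is gained from large `k`.
* `polynomialKelvinGate_two_le_of_unit` — for the orders `k ≥ 2` a SINGLE residual constant suffices: the `k = 1`,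
  `Cr = 1` instance of the stub already implies the stub for every `k ≥ 2` and every `Cr` (take `Γ ≥ max(Γ₁, 1, Cr)`, so
  that `Cr Γ^{-k} ≤ Cr Γ^{-2} ≤ Γ^{-1}`); `polynomialKelvinGate_unit` is the trivial converse specialisation.

Planner-facing remark (recorded, not acted on: this seat does not reshape stubs).  If the intended content of S2 is a
gate around base families that are `Γ^{-k}`-exact for `k` LARGE compared with `κ` (so that all such bases in one branch
are X-perturbatively close and one canonical gate transfers), the quantifier prefix would have to read
`∃ κ C₂ k₀, ∀ k ≥ k₀, ∀ Cr, ∃ Γ₁, …` (and S3 `∀ k₀, ∃ k ≥ k₀, …`); with the registered prefix the lemma below shows that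
the `k`-dependence is vacuous.
-/

set_option linter.dupNamespace false

noncomputable section

namespace Summit.NavierStokesRegularity.NavierStokesRegularity.Theorems.KelvinGate

open Set Function
open Literature.Analysis.FluidPDE
open scoped InnerProductSpace Laplacian ContDiff Topology

/-! ## `BaseSpec` is monotone in the residual budget -/

/-- **Residual monotonicity of `BaseSpec`.**  A base family of order `k` with residual constant `Cr` is a base family
of order `k'` with residual constant `Cr'` as soon as `Cr · Γ^{-k} ≤ Cr' · Γ^{-k'}`: the residual clause
`YBound (baseRes …) (Cr · Γ^{-k})` is the only clause of `BaseSpec` that mentions `(k, Cr)`, and `YBound` is monotone in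
its radius (`YBound.mono`). -/
theorem BaseSpec.of_residual_le {N : ℕ} {Γ ρ η Rw : ℝ} {k k' : ℕ} {Cs Cr Cr' : ℝ} {α : (Fin N → ℝ) → ℝ}
    {X : (Fin N → ℝ) → Fin N → ℝ → EuclideanSpace ℝ (Fin 3)}
    {u : (Fin N → ℝ) → (Fin N → ℝ → EuclideanSpace ℝ (Fin 3)) → EuclideanSpace ℝ (Fin 3) → EuclideanSpace ℝ (Fin 3)}
    {D : (Fin N → ℝ) → Fin N → EuclideanSpace ℝ (Fin 3) → EuclideanSpace ℝ (Fin 3)}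
    {U0 : (Fin N → ℝ) → EuclideanSpace ℝ (Fin 3) → EuclideanSpace ℝ (Fin 3)} {P0 : (Fin N → ℝ) → EuclideanSpace ℝ (Fin 3) → ℝ}
    {b0 : (Fin N → ℝ) → Fin N → ℝ} (h : BaseSpec N Γ ρ η Rw k Cs Cr α X u D U0 P0 b0)
    (hle : Cr * Γ ^ (-(k:ℝ)) ≤ Cr' * Γ ^ (-(k':ℝ))) :
    BaseSpec N Γ ρ η Rw k' Cs Cr' α X u D U0 P0 b0 := by
  refine ⟨h.1, fun p hp => ?_⟩
  obtain ⟨h1, h2, h3, h4, h5, h6, h7, h8, hY, h10⟩ := h.2 p hp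
  exact ⟨h1, h2, h3, h4, h5, h6, h7, h8, hY.mono hle, h10⟩

/-- **Order monotonicity of `BaseSpec`** (`Γ ≥ 1`): a base family of order `k` is a base family of every order
`k' ≤ k` with the same constants, because `Cr ≥ 0` (`BaseSpec.pos`) and `Γ^{-k} ≤ Γ^{-k'}`. -/
theorem BaseSpec.of_order_le {N : ℕ} {Γ ρ η Rw : ℝ} {k k' : ℕ} {Cs Cr : ℝ} {α : (Fin N → ℝ) → ℝ}
    {X : (Fin N → ℝ) → Fin N → ℝ → EuclideanSpace ℝ (Fin 3)}
    {u : (Fin N → ℝ) → (Fin N → ℝ → EuclideanSpace ℝ (Fin 3)) → EuclideanSpace ℝ (Fin 3) → EuclideanSpace ℝ (Fin 3)}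
    {D : (Fin N → ℝ) → Fin N → EuclideanSpace ℝ (Fin 3) → EuclideanSpace ℝ (Fin 3)}
    {U0 : (Fin N → ℝ) → EuclideanSpace ℝ (Fin 3) → EuclideanSpace ℝ (Fin 3)} {P0 : (Fin N → ℝ) → EuclideanSpace ℝ (Fin 3) → ℝ}
    {b0 : (Fin N → ℝ) → Fin N → ℝ} (h : BaseSpec N Γ ρ η Rw k Cs Cr α X u D U0 P0 b0)
    (hΓ : 1 ≤ Γ) (hk : k' ≤ k) :
    BaseSpec N Γ ρ η Rw k' Cs Cr α X u D U0 P0 b0 := by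
  have hCr : 0 ≤ Cr := (BaseSpec.pos (by linarith) h).2
  refine h.of_residual_le (mul_le_mul_of_nonneg_left ?_ hCr)
  exact Real.rpow_le_rpow_of_exponent_le hΓ (by exact_mod_cast Int.neg_le_neg (Int.ofNat_le.mpr hk))

/-- **Unit residual at order one dominates every budget at order `≥ 2`** (`Γ ≥ 1`, `Γ ≥ Cr`): a base family of order
`k ≥ 2` with residual constant `Cr` is a base family of order `1` with residual constant `1`, since
`Cr Γ^{-k} ≤ Cr Γ^{-2} ≤ Γ · Γ^{-2} = Γ^{-1}`. -/
theorem BaseSpec.order_one_unit {N : ℕ} {Γ ρ η Rw : ℝ} {k : ℕ} {Cs Cr : ℝ} {α : (Fin N → ℝ) → ℝ}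
    {X : (Fin N → ℝ) → Fin N → ℝ → EuclideanSpace ℝ (Fin 3)}
    {u : (Fin N → ℝ) → (Fin N → ℝ → EuclideanSpace ℝ (Fin 3)) → EuclideanSpace ℝ (Fin 3) → EuclideanSpace ℝ (Fin 3)}
    {D : (Fin N → ℝ) → Fin N → EuclideanSpace ℝ (Fin 3) → EuclideanSpace ℝ (Fin 3)}
    {U0 : (Fin N → ℝ) → EuclideanSpace ℝ (Fin 3) → EuclideanSpace ℝ (Fin 3)} {P0 : (Fin N → ℝ) → EuclideanSpace ℝ (Fin 3) → ℝ}
    {b0 : (Fin N → ℝ) → Fin N → ℝ} (h : BaseSpec N Γ ρ η Rw k Cs Cr α X u D U0 P0 b0)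
    (hΓ : 1 ≤ Γ) (hΓCr : Cr ≤ Γ) (hk : 2 ≤ k) :
    BaseSpec N Γ ρ η Rw 1 Cs 1 α X u D U0 P0 b0 := by
  have hCr : 0 ≤ Cr := (BaseSpec.pos (by linarith) h).2
  have hΓ0 : 0 < Γ := by linarith
  refine h.of_residual_le ?_
  have hk' : (-(k:ℝ)) ≤ -2 := by
    have : (2:ℝ) ≤ k := by exact_mod_cast hk
    linarith
  calc Cr * Γ ^ (-(k:ℝ)) ≤ Cr * Γ ^ (-(2:ℝ)) :=
        mul_le_mul_of_nonneg_left (Real.rpow_le_rpow_of_exponent_le hΓ hk') hCr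
    _ ≤ Γ * Γ ^ (-(2:ℝ)) := mul_le_mul_of_nonneg_right hΓCr (Real.rpow_nonneg hΓ0.le _)
    _ = Γ ^ (1:ℝ) * Γ ^ (-(2:ℝ)) := by rw [Real.rpow_one]
    _ = Γ ^ (-(1:ℝ)) := by rw [← Real.rpow_add hΓ0]; norm_num
    _ = 1 * Γ ^ (-((1:ℕ):ℝ)) := by norm_num

/-! ## S2 is equivalent to its order-one restriction -/

/-- **Order-one reduction of stub S2.**  `PolynomialKelvinGate` is EQUIVALENT to the same statement with the dressing
order frozen at `k = 1`: for every size constant `Cs` there are gate constants `(κ, C₂)` such that for EVERY residual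
constant `Cr`, eventually in `Γ`, every box datum and every base family of ORDER ONE (`Y(r_p) ≤ Cr · Γ⁻¹`) admits a
Kelvin gate with constants `(κ, C₂)`.  (`→`: specialise `k := 1`.  `←`: a base family of order `k ≥ 1` is a base
family of order `1` with the same `Cr` once `Γ ≥ 1`, `BaseSpec.of_order_le`; enlarge the threshold to `max Γ₁ 1`.)
So the gate constants' independence of `k` costs nothing, and the stub's burden is exactly the order-one class. -/
theorem polynomialKelvinGate_iff_order_one :
    PolynomialKelvinGate ↔
    ∀ (N : ℕ) (δ ρ K Λ a b cnd η Rw Rb cg θ₀ : ℝ), 0 < N → 0 < δ → 0 < ρ → 0 ≤ a → 0 < η → 0 < Rw → 0 < Rb → 0 < cg → 0 < θ₀ →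
    ∀ Cs : ℝ, ∃ κ C₂ : ℝ, ∀ Cr : ℝ, ∃ Γ₁ : ℝ, ∀ Γ : ℝ, Γ₁ ≤ Γ → ∀ (γ : (Fin N → ℝ) → Fin N → ℝ) (α : (Fin N → ℝ) → ℝ) (X : (Fin N → ℝ) → Fin N → ℝ → EuclideanSpace ℝ (Fin 3)) (w : (Fin N → ℝ) → Fin N → ℝ → ℝ) (c : (Fin N → ℝ) → Fin N → ℝ) (m : (Fin N → ℝ) → Fin N → EuclideanSpace ℝ (Fin 3)) (n : (Fin N → ℝ) → Fin N → EuclideanSpace ℝ (Fin 3)) (u : (Fin N → ℝ) → (Fin N → ℝ → EuclideanSpace ℝ (Fin 3)) → EuclideanSpace ℝ (Fin 3) → EuclideanSpace ℝ (Fin 3)) (v : (Fin N → ℝ) → EuclideanSpace ℝ (Fin 3) → EuclideanSpace ℝ (Fin 3)) (A : (Fin N → ℝ) → Fin N → (EuclideanSpace ℝ (Fin 3) →L[ℝ] EuclideanSpace ℝ (Fin 3))) (T : (Fin N → ℝ) → (Fin N → ℝ → EuclideanSpace ℝ (Fin 3)) → Fin N → ℝ → EuclideanSpace ℝ (Fin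 3)) (D : (Fin N → ℝ) → Fin N → EuclideanSpace ℝ (Fin 3) → EuclideanSpace ℝ (Fin 3)),
      DefU N Γ γ u → DefV N α X u v → DefA N X c v A → DefT N α u T → DefD N X c D → BoxClausesJ N Γ δ ρ K Λ a b cnd Rw Rb cg θ₀ γ α X w c m n v A T →
      ∀ (U0 : (Fin N → ℝ) → EuclideanSpace ℝ (Fin 3) → EuclideanSpace ℝ (Fin 3)) (P0 : (Fin N → ℝ) → EuclideanSpace ℝ (Fin 3) → ℝ) (b0 : (Fin N → ℝ) → Fin N → ℝ), BaseSpec N Γ ρ η Rw 1 Cs Cr α X u D U0 P0 b0 →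
      ∃ (𝓚 : (Fin N → ℝ) → (EuclideanSpace ℝ (Fin 3) → EuclideanSpace ℝ (Fin 3)) → EuclideanSpace ℝ (Fin 3) → EuclideanSpace ℝ (Fin 3)) (𝓠 : (Fin N → ℝ) → (EuclideanSpace ℝ (Fin 3) → EuclideanSpace ℝ (Fin 3)) → EuclideanSpace ℝ (Fin 3) → ℝ) (𝓑 : (Fin N → ℝ) → (EuclideanSpace ℝ (Fin 3) → EuclideanSpace ℝ (Fin 3)) → Fin N → ℝ), GateSpec N Γ κ C₂ α D U0 𝓚 𝓠 𝓑 := by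
  constructor
  · intro h N δ ρ K Λ a b cnd η Rw Rb cg θ₀ hN hδ hρ ha hη hRw hRb hcg hθ₀ Cs
    obtain ⟨κ, C₂, hk⟩ := h N δ ρ K Λ a b cnd η Rw Rb cg θ₀ hN hδ hρ ha hη hRw hRb hcg hθ₀ Cs
    exact ⟨κ, C₂, fun Cr => hk 1 le_rfl Cr⟩
  · intro h N δ ρ K Λ a b cnd η Rw Rb cg θ₀ hN hδ hρ ha hη hRw hRb hcg hθ₀ Cs
    obtain ⟨κ, C₂, hCr⟩ := h N δ ρ K Λ a b cnd η Rw Rb cg θ₀ hN hδ hρ ha hη hRw hRb hcg hθ₀ Cs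
    refine ⟨κ, C₂, fun k hk Cr => ?_⟩
    obtain ⟨Γ₁, hΓ₁⟩ := hCr Cr
    refine ⟨max Γ₁ 1, fun Γ hΓ γ α X w c m n u v A T D hu hv hA hT hD hbox U0 P0 b0 hbase => ?_⟩
    have hΓ1 : 1 ≤ Γ := (le_max_right _ _).trans hΓ
    exact hΓ₁ Γ ((le_max_left _ _).trans hΓ) γ α X w c m n u v A T D hu hv hA hT hD hbox U0 P0 b0
      (hbase.of_order_le hΓ1 hk)

/-! ## For the orders `k ≥ 2` a single residual constant suffices -/

/-- **Unit-residual reduction for the orders `k ≥ 2`.**  The `k = 1`, `Cr = 1` instance of the stub — gate constants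
`(κ, C₂)` for every base family with `Y(r_p) ≤ Γ⁻¹`, eventually in `Γ` — already gives `PolynomialKelvinGate` for
every order `k ≥ 2` and EVERY residual constant `Cr`, with the same `(κ, C₂)`: take `Γ ≥ max(Γ₁, 1, Cr)` and use
`BaseSpec.order_one_unit`. -/
theorem polynomialKelvinGate_two_le_of_unit
    (h : ∀ (N : ℕ) (δ ρ K Λ a b cnd η Rw Rb cg θ₀ : ℝ), 0 < N → 0 < δ → 0 < ρ → 0 ≤ a → 0 < η → 0 < Rw → 0 < Rb → 0 < cg → 0 < θ₀ →
    ∀ Cs : ℝ, ∃ κ C₂ : ℝ, ∃ Γ₁ : ℝ, ∀ Γ : ℝ, Γ₁ ≤ Γ → ∀ (γ : (Fin N → ℝ) → Fin N → ℝ) (α : (Fin N → ℝ) → ℝ) (X : (Fin N → ℝ) → Fin N → ℝ → EuclideanSpace ℝ (Fin 3)) (w : (Fin N → ℝ) → Fin N → ℝ → ℝ) (c : (Fin N → ℝ) → Fin N → ℝ) (m : (Fin N → ℝ) → Fin N → EuclideanSpace ℝ (Fin 3)) (n : (Fin N → ℝ) → Fin N → EuclideanSpace ℝ (Fin 3)) (u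 : (Fin N → ℝ) → (Fin N → ℝ → EuclideanSpace ℝ (Fin 3)) → EuclideanSpace ℝ (Fin 3) → EuclideanSpace ℝ (Fin 3)) (v : (Fin N → ℝ) → EuclideanSpace ℝ (Fin 3) → EuclideanSpace ℝ (Fin 3)) (A : (Fin N → ℝ) → Fin N → (EuclideanSpace ℝ (Fin 3) →L[ℝ] EuclideanSpace ℝ (Fin 3))) (T : (Fin N → ℝ) → (Fin N → ℝ → EuclideanSpace ℝ (Fin 3)) → Fin N → ℝ → EuclideanSpace ℝ (Fin 3)) (D : (Fin N → ℝ) → Fin N → EuclideanSpace ℝ (Fin 3) → EuclideanSpace ℝ (Fin 3)),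
      DefU N Γ γ u → DefV N α X u v → DefA N X c v A → DefT N α u T → DefD N X c D → BoxClausesJ N Γ δ ρ K Λ a b cnd Rw Rb cg θ₀ γ α X w c m n v A T →
      ∀ (U0 : (Fin N → ℝ) → EuclideanSpace ℝ (Fin 3) → EuclideanSpace ℝ (Fin 3)) (P0 : (Fin N → ℝ) → EuclideanSpace ℝ (Fin 3) → ℝ) (b0 : (Fin N → ℝ) → Fin N → ℝ), BaseSpec N Γ ρ η Rw 1 Cs 1 α X u D U0 P0 b0 →
      ∃ (𝓚 : (Fin N → ℝ) → (EuclideanSpace ℝ (Fin 3) → EuclideanSpace ℝ (Fin 3)) → EuclideanSpace ℝ (Fin 3) → EuclideanSpace ℝ (Fin 3)) (𝓠 : (Fin N → ℝ) → (EuclideanSpace ℝ (Fin 3) → EuclideanSpace ℝ (Fin 3)) → EuclideanSpace ℝ (Fin 3) → ℝ) (𝓑 : (Fin N → ℝ) → (EuclideanSpace ℝ (Fin 3) → EuclideanSpace ℝ (Fin 3)) → Fin N → ℝ), GateSpec N Γ κ C₂ α D U0 𝓚 𝓠 𝓑) :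
    ∀ (N : ℕ) (δ ρ K Λ a b cnd η Rw Rb cg θ₀ : ℝ), 0 < N → 0 < δ → 0 < ρ → 0 ≤ a → 0 < η → 0 < Rw → 0 < Rb → 0 < cg → 0 < θ₀ →
    ∀ Cs : ℝ, ∃ κ C₂ : ℝ, ∀ k : ℕ, 2 ≤ k → ∀ Cr : ℝ, ∃ Γ₁ : ℝ, ∀ Γ : ℝ, Γ₁ ≤ Γ → ∀ (γ : (Fin N → ℝ) → Fin N → ℝ) (α : (Fin N → ℝ) → ℝ) (X : (Fin N → ℝ) → Fin N → ℝ → EuclideanSpace ℝ (Fin 3)) (w : (Fin N → ℝ) → Fin N → ℝ → ℝ) (c : (Fin N → ℝ) → Fin N → ℝ) (m : (Fin N → ℝ) → Fin N → EuclideanSpace ℝ (Fin 3)) (n : (Fin N → ℝ) → Fin N → EuclideanSpace ℝ (Fin 3)) (u : (Fin N → ℝ) → (Fin N → ℝ → EuclideanSpace ℝ (Fin 3)) → EuclideanSpace ℝ (Fin 3) → EuclideanSpace ℝ (Fin 3)) (v : (Fin N → ℝ) → EuclideanSpace ℝ (Fin 3) → EuclideanSpace ℝ (Fin 3)) (A :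 (Fin N → ℝ) → Fin N → (EuclideanSpace ℝ (Fin 3) →L[ℝ] EuclideanSpace ℝ (Fin 3))) (T : (Fin N → ℝ) → (Fin N → ℝ → EuclideanSpace ℝ (Fin 3)) → Fin N → ℝ → EuclideanSpace ℝ (Fin 3)) (D : (Fin N → ℝ) → Fin N → EuclideanSpace ℝ (Fin 3) → EuclideanSpace ℝ (Fin 3)),
      DefU N Γ γ u → DefV N α X u v → DefA N X c v A → DefT N α u T → DefD N X c D → BoxClausesJ N Γ δ ρ K Λ a b cnd Rw Rb cg θ₀ γ α X w c m n v A T →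
      ∀ (U0 : (Fin N → ℝ) → EuclideanSpace ℝ (Fin 3) → EuclideanSpace ℝ (Fin 3)) (P0 : (Fin N → ℝ) → EuclideanSpace ℝ (Fin 3) → ℝ) (b0 : (Fin N → ℝ) → Fin N → ℝ), BaseSpec N Γ ρ η Rw k Cs Cr α X u D U0 P0 b0 →
      ∃ (𝓚 : (Fin N → ℝ) → (EuclideanSpace ℝ (Fin 3) → EuclideanSpace ℝ (Fin 3)) → EuclideanSpace ℝ (Fin 3) → EuclideanSpace ℝ (Fin 3)) (𝓠 : (Fin N → ℝ) → (EuclideanSpace ℝ (Fin 3) → EuclideanSpace ℝ (Fin 3)) → EuclideanSpace ℝ (Fin 3) → ℝ) (𝓑 : (Fin N → ℝ) → (EuclideanSpace ℝ (Fin 3) → EuclideanSpace ℝ (Fin 3)) → Fin N → ℝ), GateSpec N Γ κ C₂ α D U0 𝓚 𝓠 𝓑 := by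
  intro N δ ρ K Λ a b cnd η Rw Rb cg θ₀ hN hδ hρ ha hη hRw hRb hcg hθ₀ Cs
  obtain ⟨κ, C₂, Γ₁, hΓ₁⟩ := h N δ ρ K Λ a b cnd η Rw Rb cg θ₀ hN hδ hρ ha hη hRw hRb hcg hθ₀ Cs
  refine ⟨κ, C₂, fun k hk Cr => ⟨max (max Γ₁ 1) Cr, ?_⟩⟩
  intro Γ hΓ γ α X w c m n u v A T D hu hv hA hT hD hbox U0 P0 b0 hbase
  have hΓ1 : 1 ≤ Γ := ((le_max_right _ _).trans (le_max_left _ _)).trans hΓ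
  have hΓCr : Cr ≤ Γ := (le_max_right _ _).trans hΓ
  exact hΓ₁ Γ (((le_max_left _ _).trans (le_max_left _ _)).trans hΓ) γ α X w c m n u v A T D hu hv hA hT hD hbox
    U0 P0 b0 (hbase.order_one_unit hΓ1 hΓCr hk)

/-- The trivial converse specialisation: `PolynomialKelvinGate` gives in particular the `k = 1`, `Cr = 1` instance
used in `polynomialKelvinGate_two_le_of_unit`. -/
theorem polynomialKelvinGate_unit (hS2 : PolynomialKelvinGate) :
    ∀ (N : ℕ) (δ ρ K Λ a b cnd η Rw Rb cg θ₀ : ℝ), 0 < N → 0 < δ → 0 < ρ → 0 ≤ a → 0 < η → 0 < Rw → 0 < Rb → 0 < cg → 0 < θ₀ →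
    ∀ Cs : ℝ, ∃ κ C₂ : ℝ, ∃ Γ₁ : ℝ, ∀ Γ : ℝ, Γ₁ ≤ Γ → ∀ (γ : (Fin N → ℝ) → Fin N → ℝ) (α : (Fin N → ℝ) → ℝ) (X : (Fin N → ℝ) → Fin N → ℝ → EuclideanSpace ℝ (Fin 3)) (w : (Fin N → ℝ) → Fin N → ℝ → ℝ) (c : (Fin N → ℝ) → Fin N → ℝ) (m : (Fin N → ℝ) → Fin N → EuclideanSpace ℝ (Fin 3)) (n : (Fin N → ℝ) → Fin N → EuclideanSpace ℝ (Fin 3)) (u : (Fin N → ℝ) → (Fin N → ℝ → EuclideanSpace ℝ (Fin 3)) → EuclideanSpace ℝ (Fin 3) → EuclideanSpace ℝ (Fin 3)) (v : (Fin N → ℝ) → EuclideanSpace ℝ (Fin 3) → EuclideanSpace ℝ (Fin 3)) (A : (Fin N → ℝ) → Fin N → (EuclideanSpace ℝ (Fin 3) →L[ℝ] EuclideanSpace ℝ (Fin 3))) (T : (Fin N → ℝ) → (Fin N → ℝ → EuclideanSpace ℝ (Fin 3)) → Fin N → ℝ → EuclideanSpace ℝ (Fin 3)) (D : (Fin N →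 ℝ) → Fin N → EuclideanSpace ℝ (Fin 3) → EuclideanSpace ℝ (Fin 3)),
      DefU N Γ γ u → DefV N α X u v → DefA N X c v A → DefT N α u T → DefD N X c D → BoxClausesJ N Γ δ ρ K Λ a b cnd Rw Rb cg θ₀ γ α X w c m n v A T →
      ∀ (U0 : (Fin N → ℝ) → EuclideanSpace ℝ (Fin 3) → EuclideanSpace ℝ (Fin 3)) (P0 : (Fin N → ℝ) → EuclideanSpace ℝ (Fin 3) → ℝ) (b0 : (Fin N → ℝ) → Fin N → ℝ), BaseSpec N Γ ρ η Rw 1 Cs 1 α X u D U0 P0 b0 →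
      ∃ (𝓚 : (Fin N → ℝ) → (EuclideanSpace ℝ (Fin 3) → EuclideanSpace ℝ (Fin 3)) → EuclideanSpace ℝ (Fin 3) → EuclideanSpace ℝ (Fin 3)) (𝓠 : (Fin N → ℝ) → (EuclideanSpace ℝ (Fin 3) → EuclideanSpace ℝ (Fin 3)) → EuclideanSpace ℝ (Fin 3) → ℝ) (𝓑 : (Fin N → ℝ) → (EuclideanSpace ℝ (Fin 3) → EuclideanSpace ℝ (Fin 3)) → Fin N → ℝ), GateSpec N Γ κ C₂ α D U0 𝓚 𝓠 𝓑 := by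
  intro N δ ρ K Λ a b cnd η Rw Rb cg θ₀ hN hδ hρ ha hη hRw hRb hcg hθ₀ Cs
  obtain ⟨κ, C₂, hk⟩ := hS2 N δ ρ K Λ a b cnd η Rw Rb cg θ₀ hN hδ hρ ha hη hRw hRb hcg hθ₀ Cs
  obtain ⟨Γ₁, hΓ₁⟩ := hk 1 le_rfl 1
  exact ⟨κ, C₂, Γ₁, hΓ₁⟩

end Summit.NavierStokesRegularity.NavierStokesRegularity.Theorems.KelvinGate
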